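import Mathlib.Logic.Equiv.Fin.Basic
import Mathlib.Data.Fintype.Basic
import Mathlib.Tactic

set_option linter.dupNamespace false
set_option autoImplicit false

/-!
# Universal occurrence — two rectangles and the four-odd types `(2N-2j-3,2j+1,1,1)`: lift arithmetic, uniform in `j`
(decomp-mm · lens 3 · gen 44, K32-C)

Route `route-MatrixMultiplication-ObstructionDescent` (sub-problem `MatrixMultiplication`, `ω(ℂ) = 2`); SUPPORT for the crux
`NoOccurrenceObstruction` (`P_O`, item `stmt-MatrixMultiplication-29040`).  Pure arithmetic (no representation theory, no `def`,
no `sorry`, no enumeration): the finite bookkeeping behind the lifted design `D'_j(N)` of the hook-domino family, UNIFORM IN `j`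
— the statements of `…TwoRectangleOddFiveArith` §1 (`j = 2`) with the one-generic block `{2,3}` replaced by `{2,…,j+1}` and the
zero-generic block `{4,…,N-1}` by `{j+2,…,N-1}`.  The LOCAL SIGN RULE on the model alphabet `[6]` (`oddThree_model_SS/SC/CS/CC`,
`…TwoRectangleOddThreeArith`) is `j`-free and is reused verbatim by the family (K32 of memo NODE-g44 §7).

**The design `D'_j(N)`** (NODE-g44 §2, §4).  Alphabet `[N+2]` = generic letters `n < N` and two LIFTED letters `N, N+1`; first
leg `φ(n) = n (n < N), φ(N) = 0, φ(N+1) = 1`; second leg CROSSED, `ψ(N) = 1, ψ(N+1) = 0`; third leg (row letter of the tableau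
of shape `(2N-2j-3,2j+1,1,1)`: column `0..3`, `2j` dominoes, arm) `γ(n) = 1` for `1 ≤ n ≤ j+1`, `γ(N) = 2, γ(N+1) = 3`, `γ = 0`
otherwise.  The four column letters `n_i = ι(p_i)` of a term are classified by the MODEL LETTER `m(n) ∈ [6]` (`m(n) = n` for
`n < 2`, `2` for the ONE-GENERIC letters `2 ≤ n ≤ j+1`, `3` for the ZERO-GENERIC letters `j+2 ≤ n < N`, `n+4-N ∈ {4,5}` for the
lifted letters); the dominoes enter through `d = Σ_{i<2j} γ(ι p_{2i+4})`, tied to the column letters of block `0` by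
`d + [2 ≤ n_0 ≤ j+1] + [2 ≤ n_2 ≤ j+1] + [{n_0,n_2} ∩ {1,N+1} ≠ ∅] = j + 1`.

**Contents.**  Transfer to the model alphabet (`fourOddLetter_*`; `split_ifs`/`omega` only; hypothesis `j + 2 ≤ N`).

[cite: BurgisserIkenmeyer2011, Thm. 4.4, Lemma 6.1] [cite: BurgisserIkenmeyer2017, §5, Thm. 5.9 (proof of (2)), eq. (3.4)]
-/

namespace Summit.MatrixMultiplication.MatrixMultiplication.Theorems.ObstructionCalculus

/-! ### Transfer to the model alphabet `[6]` -/

/-- The model letter is `< 6`. [this node] -/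
theorem fourOddLetter_lt {N j n k : ℕ} (hn : n < N + 2) (hk : k = (if n < 2 then n else if n < j + 2 then 2 else if n < N then 3 else n + 4 - N)) : k < 6 := by
  subst hk
  split_ifs <;> omega

/-- The row letter `γ(n)` is read off the model letter. [this node] -/
theorem fourOddLetter_col {N j n k : ℕ} (hN : j + 2 ≤ N) (hn : n < N + 2) (hk : k = (if n < 2 then n else if n < j + 2 then 2 else if n < N then 3 else n + 4 - N)) :
    (if n = 0 then 0 else if n < j + 2 then 1 else if n = N then 2 else if n = N + 1 then 3 else 0) =
      (if k = 1 then 1 else if k = 2 then 1 else if k = 4 then 2 else if k = 5 then 3 else 0) := by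
  have hk2 : (n < 2 ∧ k = n) ∨ (2 ≤ n ∧ n < j + 2 ∧ k = 2) ∨ (j + 2 ≤ n ∧ n < N ∧ k = 3) ∨ (N ≤ n ∧ k = n + 4 - N) := by
    rw [hk]; split_ifs <;> omega
  clear hk
  split_ifs <;> omega

/-- A one-generic letter `2 ≤ n ≤ j+1` has row letter `1`. [this node] -/
theorem fourOddLetter_col_oneGeneric {N j n : ℕ} (h2 : 2 ≤ n) (hn : n < j + 2) :
    (if n = 0 then 0 else if n < j + 2 then 1 else if n = N then 2 else if n = N + 1 then 3 else 0) = 1 := by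
  split_ifs <;> omega

/-- A zero-generic letter `j+2 ≤ n < N` has row letter `0`. [this node] -/
theorem fourOddLetter_col_zeroGeneric {N j n : ℕ} (h4 : j + 2 ≤ n) (hn : n < N) :
    (if n = 0 then 0 else if n < j + 2 then 1 else if n = N then 2 else if n = N + 1 then 3 else 0) = 0 := by
  split_ifs <;> omega

/-- `φ(n) = ψ(n')` transfers to the model letters. [this node] -/
theorem fourOddLetter_eq {N j n n' k k' : ℕ} (hN : j + 2 ≤ N) (hn : n < N + 2) (hn' : n' < N + 2) (hk : k = (if n < 2 then n else if n < j + 2 then 2 else if n < N then 3 else n + 4 - N))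
    (hk' : k' = (if n' < 2 then n' else if n' < j + 2 then 2 else if n' < N then 3 else n' + 4 - N)) (h : (if n < N then n else n - N) = (if n' < N then n' else N + 1 - n')) :
    (if k < 4 then k else k - 4) = (if k' < 4 then k' else 5 - k') := by
  have hk2 : (n < 2 ∧ k = n) ∨ (2 ≤ n ∧ n < j + 2 ∧ k = 2) ∨ (j + 2 ≤ n ∧ n < N ∧ k = 3) ∨ (N ≤ n ∧ k = n + 4 - N) := by
    rw [hk]; split_ifs <;> omega
  have hk2' : (n' < 2 ∧ k' = n') ∨ (2 ≤ n' ∧ n' < j + 2 ∧ k' = 2) ∨ (j + 2 ≤ n' ∧ n' < N ∧ k' = 3) ∨ (N ≤ n' ∧ k' = n' + 4 - N) := by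
    rw [hk']; split_ifs <;> omega
  have hh : (n < N ∧ n' < N ∧ n = n') ∨ (n < N ∧ N ≤ n' ∧ n = N + 1 - n') ∨ (N ≤ n ∧ n' < N ∧ n - N = n') ∨
      (N ≤ n ∧ N ≤ n' ∧ n - N = N + 1 - n') := by
    split_ifs at h <;> omega
  clear hk hk' h
  split_ifs <;> omega

/-- `φ(n) ≠ φ(n')` transfers to the model letters unless both letters are generic of the same kind. [this node] -/
theorem fourOddLetter_ne_fst {N j n n' k k' : ℕ} (hN : j + 2 ≤ N) (hn : n < N + 2) (hn' : n' < N + 2) (hk : k = (if n < 2 then n else if n < j + 2 then 2 else if n < N then 3 else n + 4 - N))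
    (hk' : k' = (if n' < 2 then n' else if n' < j + 2 then 2 else if n' < N then 3 else n' + 4 - N)) (hgen₁ : ¬ (2 ≤ n ∧ n < j + 2 ∧ 2 ≤ n' ∧ n' < j + 2))
    (hgen₀ : ¬ (j + 2 ≤ n ∧ n < N ∧ j + 2 ≤ n' ∧ n' < N))
    (h : (if n < N then n else n - N) ≠ (if n' < N then n' else n' - N)) :
    (if k < 4 then k else k - 4) ≠ (if k' < 4 then k' else k' - 4) := by
  have hk2 : (n < 2 ∧ k = n) ∨ (2 ≤ n ∧ n < j + 2 ∧ k = 2) ∨ (j + 2 ≤ n ∧ n < N ∧ k = 3) ∨ (N ≤ n ∧ k = n + 4 - N) := by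
    rw [hk]; split_ifs <;> omega
  have hk2' : (n' < 2 ∧ k' = n') ∨ (2 ≤ n' ∧ n' < j + 2 ∧ k' = 2) ∨ (j + 2 ≤ n' ∧ n' < N ∧ k' = 3) ∨ (N ≤ n' ∧ k' = n' + 4 - N) := by
    rw [hk']; split_ifs <;> omega
  have hh : (n < N ∧ n' < N ∧ n ≠ n') ∨ (n < N ∧ N ≤ n' ∧ n ≠ n' - N) ∨ (N ≤ n ∧ n' < N ∧ n - N ≠ n') ∨
      (N ≤ n ∧ N ≤ n' ∧ n ≠ n') := by
    split_ifs at h <;> omega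
  clear hk hk' h
  split_ifs <;> omega

/-- `ψ(n) ≠ ψ(n')` transfers to the model letters unless both letters are generic of the same kind. [this node] -/
theorem fourOddLetter_ne_snd {N j n n' k k' : ℕ} (hN : j + 2 ≤ N) (hn : n < N + 2) (hn' : n' < N + 2) (hk : k = (if n < 2 then n else if n < j + 2 then 2 else if n < N then 3 else n + 4 - N))
    (hk' : k' = (if n' < 2 then n' else if n' < j + 2 then 2 else if n' < N then 3 else n' + 4 - N)) (hgen₁ : ¬ (2 ≤ n ∧ n < j + 2 ∧ 2 ≤ n' ∧ n' < j + 2))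
    (hgen₀ : ¬ (j + 2 ≤ n ∧ n < N ∧ j + 2 ≤ n' ∧ n' < N))
    (h : (if n < N then n else N + 1 - n) ≠ (if n' < N then n' else N + 1 - n')) :
    (if k < 4 then k else 5 - k) ≠ (if k' < 4 then k' else 5 - k') := by
  have hk2 : (n < 2 ∧ k = n) ∨ (2 ≤ n ∧ n < j + 2 ∧ k = 2) ∨ (j + 2 ≤ n ∧ n < N ∧ k = 3) ∨ (N ≤ n ∧ k = n + 4 - N) := by
    rw [hk]; split_ifs <;> omega
  have hk2' : (n' < 2 ∧ k' = n') ∨ (2 ≤ n' ∧ n' < j + 2 ∧ k' = 2) ∨ (j + 2 ≤ n' ∧ n' < N ∧ k' = 3) ∨ (N ≤ n' ∧ k' = n' + 4 - N) := by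
    rw [hk']; split_ifs <;> omega
  have hh : (n < N ∧ n' < N ∧ n ≠ n') ∨ (n < N ∧ N ≤ n' ∧ n ≠ N + 1 - n') ∨ (N ≤ n ∧ n' < N ∧ N + 1 - n ≠ n') ∨
      (N ≤ n ∧ N ≤ n' ∧ n ≠ n') := by
    split_ifs at h <;> omega
  clear hk hk' h
  split_ifs <;> omega

/-- The domino correction `[2 ≤ n ≤ j+1] + [2 ≤ n' ≤ j+1] + [{n,n'} ∩ {1,N+1} ≠ ∅]` is read off the model letters when
the two letters have different row letters. [this node] -/
theorem fourOddLetter_dd {N j n n' k k' : ℕ} (hN : j + 2 ≤ N) (hn : n < N + 2) (hn' : n' < N + 2) (hk : k = (if n < 2 then n else if n < j + 2 then 2 else if n < N then 3 else n + 4 - N))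
    (hk' : k' = (if n' < 2 then n' else if n' < j + 2 then 2 else if n' < N then 3 else n' + 4 - N))
    (hne : (if k = 1 then 1 else if k = 2 then 1 else if k = 4 then 2 else if k = 5 then 3 else 0) ≠
      (if k' = 1 then 1 else if k' = 2 then 1 else if k' = 4 then 2 else if k' = 5 then 3 else 0)) :
    ((if 2 ≤ n ∧ n < j + 2 then 1 else 0) + (if 2 ≤ n' ∧ n' < j + 2 then 1 else 0) + (if n = 1 ∨ n' = 1 ∨ n = N + 1 ∨ n' = N + 1 then 1 else 0)) =
      ((if k = 2 ∨ k' = 2 then 1 else 0) + (if k = 1 ∨ k' = 1 ∨ k = 5 ∨ k' = 5 then 1 else 0)) := by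
  have hk2 : (n < 2 ∧ k = n) ∨ (2 ≤ n ∧ n < j + 2 ∧ k = 2) ∨ (j + 2 ≤ n ∧ n < N ∧ k = 3) ∨ (N ≤ n ∧ k = n + 4 - N) := by
    rw [hk]; split_ifs <;> omega
  have hk2' : (n' < 2 ∧ k' = n') ∨ (2 ≤ n' ∧ n' < j + 2 ∧ k' = 2) ∨ (j + 2 ≤ n' ∧ n' < N ∧ k' = 3) ∨ (N ≤ n' ∧ k' = n' + 4 - N) := by
    rw [hk']; split_ifs <;> omega
  have hkk : ¬ (k = 2 ∧ k' = 2) := fun hh => by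
    obtain ⟨h1, h2⟩ := hh
    rw [h1, h2] at hne
    exact hne rfl
  clear hk hk' hne
  split_ifs <;> omega

end Summit.MatrixMultiplication.MatrixMultiplication.Theorems.ObstructionCalculus
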